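/-
Copyright: internal research formalization. Source: Y. Filmus, G. Kindler, N. Lifshitz, D. Minzer,
*Hypercontractivity on the symmetric group*, Forum of Mathematics, Sigma 12 (2024) e6 = arXiv:2009.05503
[FilmusKindlerLifshitzMinzer2024], §7.4 "Deducing results for the multi-cube": Definitions 7.14–7.15 and the
coupling in the proof of Theorem 7.16 (held text `paper:arxiv-2009.05503`, chunks p0028–p0029).
-/
import Literature.Combinatorics.Additive.GlobalLevelInequalityBounded
import HarnessLib

/-!
# The deterministic coupling of a slice with the symmetric group (Filmus–Kindler–Lifshitz–Minzer §7.4) — PROVED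

Filmus–Kindler–Lifshitz–Minzer, *Hypercontractivity on the symmetric group* (Forum Math. Sigma 2024),
§7.4, proof of Theorem 7.16, verbatim: *"We construct a simple deterministic coupling `𝒞` between `S_n`
and `𝒰_{k_1,…,k_m}`. Fix a partition of `[n]` into sets `K_1, …, K_m` such that `|K_j| = k_j` for all `j`.
Given a permutation `π`, we define `𝒞(π) = x` as follows: for all `i ∈ [n]`, `j ∈ [m]`, we set `x_i = j` if
`π(i) ∈ K_j`. Define the mapping `M : L²(𝒰_{k_1,…,k_m}) → L²(S_n)` […] by `(Mh)(π) = h(𝒞(π))`. […] To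
see that `g` is global, let `T = {(i_1,r_1),…,(i_ℓ,r_ℓ)}` be consistent, and define the `r`-restriction
`(A, α)` as: `A = {i_1,…,i_ℓ}`, and `α_{i_s} = j` if `r_s ∈ K_j`. Note that the distribution of
`x ∈ 𝒰_{k_1,…,k_m}` conditioned on `x_A` is exactly the same as of `𝒞(π)` conditioned on `π` respecting
`T` […] The result thus follows from […] the fact that `M` preserves `L_p` norms for all `p ≥ 1`."* (and
p. 6: the correspondence *"preserves degrees, globalness, and `L_p` norms"*).

This file proves the two-block case `m = 2` (the SLICE `([n] choose t)`, `K_1 = T₀` a fixed `t`-set),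
which is the case the cell needs (odd cuts `U` of a fixed size `t` as one factor of the crux's domain
`(t-cuts) × PM_n`; lit memo LIT-62 §7, prover MEMO-37 §4(b) (WL)): the coupling `π ↦ U(π) = π⁻¹(T₀)`
(`cutOf`), the lift `(Mh)(π) = h(U(π))` (`liftCut`), and the EXACT push-forward identities behind "the
distribution of `x` conditioned on `x_A` is exactly the same as of `𝒞(π)` conditioned on `π` respecting
`T`" and "`M` preserves `L_p` norms", in the counting normalisation of the tree's `S_n` files
(`umvirate I J = {π : π ∘ I = J}` of `GlobalProductMixing.lean`, `IsL1GlobalSn` / `IsBiglobal` of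
`GlobalLevelInequalityBounded.lean` / `GlobalLevelInequalityBiglobal.lean`):

* `cutOf T₀ π = {i : π i ∈ T₀}` (`= T₀.map π⁻¹`, `card_cutOf`), `liftCut T₀ h π = h (cutOf T₀ π)`;
  `subslice T₀ I J` = the `t`-sets `U` with the prescribed pattern `I k ∈ U ⟺ J k ∈ T₀` on the restricted
  coordinates (= the sub-slice `{x_A = α}` of Def. 7.14's restriction), `cutOf_mem_subslice` (a permutation
  respecting `T = {(I k, J k)}` is coupled into that sub-slice);
* **`card_mul_sum_liftCut`** — the push-forward of the uniform measure on the umvirate `U_{I→J}` under `𝒞`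
  is the uniform measure on the sub-slice: for EVERY test function `F`,
  `|subslice| · Σ_{π ∈ U_{I→J}} F(U(π)) = |U_{I→J}| · Σ_{U ∈ subslice} F(U)` (proof: the pointwise stabiliser
  of `range I` in `S_n` acts on the fibres by right translation, `cutOf_mul`, and transitively on the
  sub-slice, `exists_perm_fix_map` — Mathlib's `Equiv.Perm.exists_extending_pair`);
* **`choose_mul_sum_liftCut`** — the case of no restriction: `C(n,t) · Σ_π F(U(π)) = n! · Σ_{|U|=t} F(U)`,
  i.e. "`M` preserves `L_p` norms" (take `F = |h|^p`);
* `IsL1GlobalSlice` / `IsBiglobalSlice` — Def. 7.15-style restriction globalness of a function on the slice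
  (`L¹`, resp. `L¹` and `L²`, averages over every sub-slice with `≤ d` restricted coordinates bounded by
  `r^{#coords} γ`), and the transfer **`isL1GlobalSn_liftCut`** / **`isBiglobal_liftCut`**: the lift of a
  global function on the slice is a global function on `S_n` with the SAME parameters — so the tree's
  PROVED Keevash–Lifshitz Theorem 3.1 (`GlobalLevelDInequalityBiglobal_holds`,
  `levelPart_sq_le_of_isL1GlobalSn`) applies to lifted slice functions.

Not here: the degree bookkeeping of the coupling (`M` maps `d`-juntas to `d`-juntas; Cor. 7.17's
"additional easy property") and the multislice with `m ≥ 3` blocks — TODO(general form). 0 facts, 0 sorries.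
Label: instrument/catalogue for the F-N2 rung; nothing about psd rank or P-vs-NP.

## References
* [FilmusKindlerLifshitzMinzer2024] Y. Filmus, G. Kindler, N. Lifshitz, D. Minzer, *Hypercontractivity on the
  symmetric group*, Forum Math. Sigma 12 (2024) e6, doi:10.1017/fms.2023.118, arXiv:2009.05503 — §7.4,
  Def. 7.14/7.15, Thm. 7.16 (proof), Cor. 7.17.
* [KeevashLifshitz2023] P. Keevash, N. Lifshitz, arXiv:2307.15030 — §1.2 (umvirates), Def. 1.4.
-/

noncomputable section

namespace Literature.Combinatorics.Additive.KeevashLifshitz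

open Finset

variable {n : ℕ}

/-! ## The coupling `π ↦ U(π)` and the lift `M` -/

/-- **The coupling `𝒞` for two blocks**: the `t`-set read off a permutation, `U(π) = {i : π(i) ∈ T₀}`
("we set `x_i = j` if `π(i) ∈ K_j`", with `K_1 = T₀`). [cite: FilmusKindlerLifshitzMinzer2024, §7.4 Thm. 7.16 (proof)] -/
def cutOf (T₀ : Finset (Fin n)) (π : Equiv.Perm (Fin n)) : Finset (Fin n) :=
  Finset.univ.filter fun i => π i ∈ T₀

/-- Membership in `U(π)`. [cite: FilmusKindlerLifshitzMinzer2024, §7.4 Thm. 7.16 (proof)] -/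
theorem mem_cutOf {T₀ : Finset (Fin n)} {π : Equiv.Perm (Fin n)} {i : Fin n} :
    i ∈ cutOf T₀ π ↔ π i ∈ T₀ := by
  simp [cutOf]

/-- `U(π) = π⁻¹(T₀)` as an image. [cite: FilmusKindlerLifshitzMinzer2024, §7.4 Thm. 7.16 (proof)] -/
theorem cutOf_eq_map (T₀ : Finset (Fin n)) (π : Equiv.Perm (Fin n)) :
    cutOf T₀ π = T₀.map π.symm.toEmbedding := by
  ext i
  rw [mem_cutOf, Finset.mem_map_equiv, Equiv.symm_symm]

/-- `|U(π)| = |T₀|`: the coupling lands in the slice of `T₀`'s size.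
[cite: FilmusKindlerLifshitzMinzer2024, §7.4 Thm. 7.16 (proof)] -/
theorem card_cutOf (T₀ : Finset (Fin n)) (π : Equiv.Perm (Fin n)) : (cutOf T₀ π).card = T₀.card := by
  rw [cutOf_eq_map, Finset.card_map]

/-- Right translation acts on the coupling by the image: `i ∈ U(π σ) ⟺ σ i ∈ U(π)`.
[cite: FilmusKindlerLifshitzMinzer2024, §7.4 Thm. 7.16 (proof)] -/
theorem mem_cutOf_mul {T₀ : Finset (Fin n)} {π σ : Equiv.Perm (Fin n)} {i : Fin n} :
    i ∈ cutOf T₀ (π * σ) ↔ σ i ∈ cutOf T₀ π := by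
  rw [mem_cutOf, mem_cutOf, Equiv.Perm.mul_apply]

/-- `U(π σ⁻¹) = σ(U(π))`. [cite: FilmusKindlerLifshitzMinzer2024, §7.4 Thm. 7.16 (proof)] -/
theorem cutOf_mul_inv (T₀ : Finset (Fin n)) (π σ : Equiv.Perm (Fin n)) :
    cutOf T₀ (π * σ⁻¹) = (cutOf T₀ π).map σ.toEmbedding := by
  ext i
  rw [mem_cutOf_mul, Finset.mem_map_equiv, Equiv.Perm.inv_def]

/-- **The lift `M : L²(slice) → L²(S_n)`**, `(Mh)(π) = h(U(π))`.
[cite: FilmusKindlerLifshitzMinzer2024, §7.4 Thm. 7.16 (proof)] -/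
def liftCut (T₀ : Finset (Fin n)) (h : Finset (Fin n) → ℝ) : Equiv.Perm (Fin n) → ℝ := fun π => h (cutOf T₀ π)

/-- [cite: FilmusKindlerLifshitzMinzer2024, §7.4 Thm. 7.16 (proof)] -/
theorem liftCut_apply (T₀ : Finset (Fin n)) (h : Finset (Fin n) → ℝ) (π : Equiv.Perm (Fin n)) :
    liftCut T₀ h π = h (cutOf T₀ π) := rfl

/-! ## Sub-slices and the conditional law of the coupling -/

/-- **The sub-slice of a restriction**: the `|T₀|`-sets `U` with the prescribed pattern on the restricted
coordinates `I k` — `I k ∈ U` iff the target `J k` lies in `T₀` (Def. 7.14: the restriction `x_A = α` with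
`A = {I k}`, `α_k = 1[J k ∈ T₀]`, "whose domain is a different multi-slice").
[cite: FilmusKindlerLifshitzMinzer2024, §7.4 Def. 7.14] -/
def subslice (T₀ : Finset (Fin n)) {s : ℕ} (I J : Fin s → Fin n) : Finset (Finset (Fin n)) :=
  (Finset.univ.powersetCard T₀.card).filter fun U => ∀ k, I k ∈ U ↔ J k ∈ T₀

/-- Membership in a sub-slice. [cite: FilmusKindlerLifshitzMinzer2024, §7.4 Def. 7.14] -/
theorem mem_subslice {T₀ : Finset (Fin n)} {s : ℕ} {I J : Fin s → Fin n} {U : Finset (Fin n)} :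
    U ∈ subslice T₀ I J ↔ U.card = T₀.card ∧ ∀ k, I k ∈ U ↔ J k ∈ T₀ := by
  simp [subslice, Finset.mem_powersetCard]

/-- **A permutation respecting `T = {(I k, J k)}` is coupled into the sub-slice `{x_A = α}`.**
[cite: FilmusKindlerLifshitzMinzer2024, §7.4 Thm. 7.16 (proof)] -/
theorem cutOf_mem_subslice {T₀ : Finset (Fin n)} {s : ℕ} {I J : Fin s → Fin n} {π : Equiv.Perm (Fin n)}
    (hπ : π ∈ umvirate I J) : cutOf T₀ π ∈ subslice T₀ I J := by
  rw [mem_subslice]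
  refine ⟨card_cutOf T₀ π, fun k => ?_⟩
  rw [mem_cutOf, (mem_umvirate.1 hπ) k]

/-- With no restricted coordinate the sub-slice is the whole slice.
[cite: FilmusKindlerLifshitzMinzer2024, §7.4 Def. 7.14] -/
theorem subslice_fin_zero (T₀ : Finset (Fin n)) (I J : Fin 0 → Fin n) :
    subslice T₀ I J = Finset.univ.powersetCard T₀.card := by
  ext U
  rw [mem_subslice, Finset.mem_powersetCard]
  simp

/-- The fibre of the coupling over `U` inside the umvirate. [cite: FilmusKindlerLifshitzMinzer2024, §7.4 Thm. 7.16 (proof)] -/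
def fibre (T₀ : Finset (Fin n)) {s : ℕ} (I J : Fin s → Fin n) (U : Finset (Fin n)) : Finset (Equiv.Perm (Fin n)) :=
  (umvirate I J).filter fun π => cutOf T₀ π = U

/-- **Right translation by a permutation fixing the restricted coordinates maps fibres to fibres**:
`π ↦ π σ⁻¹` is a bijection `fibre(U) → fibre(σ U)` inside `U_{I→J}` when `σ (I k) = I k` for all `k`.
[cite: FilmusKindlerLifshitzMinzer2024, §7.4 Thm. 7.16 (proof)] -/
theorem card_fibre_map {T₀ : Finset (Fin n)} {s : ℕ} {I J : Fin s → Fin n} {σ : Equiv.Perm (Fin n)}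
    (hσ : ∀ k, σ (I k) = I k) (U : Finset (Fin n)) :
    (fibre T₀ I J U).card = (fibre T₀ I J (U.map σ.toEmbedding)).card := by
  classical
  have hσ' : ∀ k, σ⁻¹ (I k) = I k := fun k => by
    rw [Equiv.Perm.inv_def, Equiv.symm_apply_eq]; exact (hσ k).symm
  refine Finset.card_nbij' (fun π => π * σ⁻¹) (fun π => π * σ) (fun π hπ => ?_) (fun π hπ => ?_)
    (fun π _ => by simp) (fun π _ => by simp)
  · rw [fibre, Finset.mem_coe, Finset.mem_filter] at hπ ⊢
    refine ⟨mem_umvirate.2 fun k => ?_, ?_⟩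
    · rw [Equiv.Perm.mul_apply, hσ' k]; exact (mem_umvirate.1 hπ.1) k
    · rw [cutOf_mul_inv, hπ.2]
  · rw [fibre, Finset.mem_coe, Finset.mem_filter] at hπ ⊢
    refine ⟨mem_umvirate.2 fun k => ?_, ?_⟩
    · rw [Equiv.Perm.mul_apply, hσ k]; exact (mem_umvirate.1 hπ.1) k
    · ext i
      rw [mem_cutOf_mul, hπ.2, Finset.mem_map_equiv, Equiv.symm_apply_apply]

/-- **The pointwise stabiliser of the restricted coordinates acts transitively on the sub-slice**: for
`U, U'` in the sub-slice there is `σ` with `σ (I k) = I k` for all `k` and `σ(U) = U'` (`I` injective).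
[cite: FilmusKindlerLifshitzMinzer2024, §7.4 Thm. 7.16 (proof: "the distribution of x conditioned on x_A is exactly the same as of C(π) conditioned on π respecting T")] -/
theorem exists_perm_fix_map {T₀ : Finset (Fin n)} {s : ℕ} {I J : Fin s → Fin n} (hI : Function.Injective I)
    {U U' : Finset (Fin n)} (hU : U ∈ subslice T₀ I J) (hU' : U' ∈ subslice T₀ I J) :
    ∃ σ : Equiv.Perm (Fin n), (∀ k, σ (I k) = I k) ∧ U.map σ.toEmbedding = U' := by
  classical
  rw [mem_subslice] at hU hU'
  set R : Finset (Fin n) := Finset.univ.image I with hR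
  have hpat : ∀ k, (I k ∈ U ↔ I k ∈ U') := fun k => (hU.2 k).trans (hU'.2 k).symm
  have hinter : U ∩ R = U' ∩ R := by
    ext x
    simp only [Finset.mem_inter]
    constructor
    · rintro ⟨hx, hxR⟩
      obtain ⟨k, -, rfl⟩ := Finset.mem_image.1 hxR
      exact ⟨(hpat k).1 hx, hxR⟩
    · rintro ⟨hx, hxR⟩
      obtain ⟨k, -, rfl⟩ := Finset.mem_image.1 hxR
      exact ⟨(hpat k).2 hx, hxR⟩
  have hcd : (U \ R).card = (U' \ R).card := by
    have h1 := Finset.card_sdiff_add_card_inter U R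
    have h2 := Finset.card_sdiff_add_card_inter U' R
    rw [hinter, hU.1] at h1
    rw [hU'.1] at h2
    omega
  let e : ↥(U \ R) ≃ ↥(U' \ R) := Finset.equivOfCardEq hcd
  let f : Fin s ⊕ ↥(U \ R) → Fin n := Sum.elim I fun x => x.1
  let g : Fin s ⊕ ↥(U \ R) → Fin n := Sum.elim I fun x => (e x).1
  have hIR : ∀ k, I k ∈ R := fun k => Finset.mem_image.2 ⟨k, Finset.mem_univ _, rfl⟩
  have hf : Function.Injective f := by
    rintro (k | x) (k' | x') h
    · change I k = I k' at h
      exact congrArg Sum.inl (hI h)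
    · change I k = x'.1 at h
      exact absurd (h ▸ hIR k) (Finset.mem_sdiff.1 x'.2).2
    · change x.1 = I k' at h
      exact absurd (h.symm ▸ hIR k') (Finset.mem_sdiff.1 x.2).2
    · change x.1 = x'.1 at h
      exact congrArg Sum.inr (Subtype.ext h)
  have hg : Function.Injective g := by
    rintro (k | x) (k' | x') h
    · change I k = I k' at h
      exact congrArg Sum.inl (hI h)
    · change I k = (e x').1 at h
      exact absurd (h ▸ hIR k) (Finset.mem_sdiff.1 (e x').2).2
    · change (e x).1 = I k' at h
      exact absurd (h.symm ▸ hIR k') (Finset.mem_sdiff.1 (e x).2).2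
    · change (e x).1 = (e x').1 at h
      exact congrArg Sum.inr (e.injective (Subtype.ext h))
  obtain ⟨σ, hσ⟩ := Equiv.Perm.exists_extending_pair f g hf hg
  have hσI : ∀ k, σ (I k) = I k := fun k => hσ (Sum.inl k)
  refine ⟨σ, hσI, ?_⟩
  apply Finset.eq_of_subset_of_card_le
  · intro y hy
    obtain ⟨u, hu, rfl⟩ := Finset.mem_map.1 hy
    change σ u ∈ U'
    by_cases huR : u ∈ R
    · obtain ⟨k, -, rfl⟩ := Finset.mem_image.1 huR
      rw [hσI k]
      exact (hpat k).1 hu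
    · have hux : u ∈ U \ R := Finset.mem_sdiff.2 ⟨hu, huR⟩
      have hσu : σ u = (e ⟨u, hux⟩).1 := hσ (Sum.inr ⟨u, hux⟩)
      rw [hσu]
      exact (Finset.mem_sdiff.1 (e ⟨u, hux⟩).2).1
  · rw [Finset.card_map, hU'.1, hU.1]

/-- **The conditional law of the coupling is uniform on the sub-slice** ("the distribution of
`x ∈ 𝒰` conditioned on `x_A` is exactly the same as of `𝒞(π)` conditioned on `π` respecting `T`"), as an
exact identity for every test function `F`:
`|subslice| · Σ_{π ∈ U_{I→J}} F(U(π)) = |U_{I→J}| · Σ_{U ∈ subslice} F(U)` (`I` injective).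
[cite: FilmusKindlerLifshitzMinzer2024, §7.4 Thm. 7.16 (proof)] -/
theorem card_mul_sum_liftCut (T₀ : Finset (Fin n)) {s : ℕ} (I J : Fin s → Fin n) (hI : Function.Injective I)
    (F : Finset (Fin n) → ℝ) :
    ((subslice T₀ I J).card : ℝ) * ∑ π ∈ umvirate I J, F (cutOf T₀ π) =
      ((umvirate I J).card : ℝ) * ∑ U ∈ subslice T₀ I J, F U := by
  classical
  -- partition the umvirate by the value of the coupling
  have hpart : ∀ G : Finset (Fin n) → ℝ,
      ∑ π ∈ umvirate I J, G (cutOf T₀ π) = ∑ U ∈ subslice T₀ I J, ((fibre T₀ I J U).card : ℝ) * G U := by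
    intro G
    rw [← Finset.sum_fiberwise_of_maps_to' (g := cutOf T₀) (fun π hπ => cutOf_mem_subslice hπ) G]
    refine Finset.sum_congr rfl fun U _ => ?_
    rw [Finset.sum_const, nsmul_eq_mul]
    rfl
  have hcardU : ((umvirate I J).card : ℝ) = ∑ U ∈ subslice T₀ I J, ((fibre T₀ I J U).card : ℝ) := by
    have h := hpart fun _ => 1
    simpa using h
  rcases (subslice T₀ I J).eq_empty_or_nonempty with hS | ⟨U₀, hU₀⟩
  · rw [hpart, hS]; simp
  · -- all fibres over the sub-slice have the same size
    have hconst : ∀ U ∈ subslice T₀ I J, ((fibre T₀ I J U).card : ℝ) = (fibre T₀ I J U₀).card := by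
      intro U hU
      obtain ⟨σ, hσI, hσU⟩ := exists_perm_fix_map hI hU₀ hU
      rw [card_fibre_map hσI U₀, hσU]
    rw [hpart, hcardU, Finset.sum_congr rfl fun U hU => by rw [hconst U hU],
      Finset.sum_congr rfl fun U hU => hconst U hU, Finset.sum_const, nsmul_eq_mul, ← Finset.mul_sum]
    ring

/-- **"`M` preserves `L_p` norms"**: with no restriction, `C(n,t) · Σ_π F(U(π)) = n! · Σ_{|U| = t} F(U)`
(`t = |T₀|`); take `F = |h|^p`. [cite: FilmusKindlerLifshitzMinzer2024, §7.4 Thm. 7.16 (proof: "the fact that M preserves L_p norms for all p ≥ 1")] -/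
theorem choose_mul_sum_liftCut (T₀ : Finset (Fin n)) (F : Finset (Fin n) → ℝ) :
    ((n.choose T₀.card : ℕ) : ℝ) * ∑ π, F (cutOf T₀ π) =
      ((Nat.factorial n : ℕ) : ℝ) * ∑ U ∈ Finset.univ.powersetCard T₀.card, F U := by
  have h := card_mul_sum_liftCut T₀ (Fin.elim0 : Fin 0 → Fin n) (Fin.elim0 : Fin 0 → Fin n)
    (fun a => Fin.elim0 a) F
  rw [subslice_fin_zero, umvirate_fin_zero, Finset.card_powersetCard, Finset.card_univ, Finset.card_univ,
    Fintype.card_fin, Fintype.card_perm, Fintype.card_fin] at h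
  exact h

/-! ## Globalness transfers along the coupling -/

/-- **`L¹`-globalness on the slice** (Def. 7.15 with `L¹` averages, bounded by `r^{#restricted coords}·γ`,
depth `≤ d`), in the restriction currency of this file: for every `s ≤ d` and injective `I, J : Fin s → Fin n`,
`Σ_{U ∈ subslice} |h U| ≤ r^s γ |subslice|`. (The sub-slice only depends on the restricted set `{I k}` and
the pattern `1[J k ∈ T₀]`; every restriction `x_A = α` of the slice arises this way or is empty.)
[cite: FilmusKindlerLifshitzMinzer2024, §7.4 Def. 7.15] [cite: KeevashLifshitz2023, Def. 1.4 (p. 11)] -/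
def IsL1GlobalSlice (T₀ : Finset (Fin n)) (r γ : ℝ) (d : ℕ) (h : Finset (Fin n) → ℝ) : Prop :=
  ∀ s : ℕ, s ≤ d → ∀ I J : Fin s → Fin n, Function.Injective I → Function.Injective J →
    (∑ U ∈ subslice T₀ I J, |h U|) ≤ r ^ s * γ * ((subslice T₀ I J).card : ℝ)

/-- **Biglobalness on the slice**: the `L¹` and `L²` sub-slice averages are bounded by `r^s γ₁` and
`(r^s γ₂)²`. [cite: FilmusKindlerLifshitzMinzer2024, §7.4 Def. 7.15] [cite: KeevashLifshitz2023, Def. 1.4 (p. 11)] -/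
def IsBiglobalSlice (T₀ : Finset (Fin n)) (r γ₁ γ₂ : ℝ) (d : ℕ) (h : Finset (Fin n) → ℝ) : Prop :=
  ∀ s : ℕ, s ≤ d → ∀ I J : Fin s → Fin n, Function.Injective I → Function.Injective J →
    (∑ U ∈ subslice T₀ I J, |h U|) ≤ r ^ s * γ₁ * ((subslice T₀ I J).card : ℝ) ∧
    (∑ U ∈ subslice T₀ I J, h U ^ 2) ≤ (r ^ s * γ₂) ^ 2 * ((subslice T₀ I J).card : ℝ)

/-- The transfer step: a sub-slice average bound becomes the same umvirate average bound for the lift.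
[cite: FilmusKindlerLifshitzMinzer2024, §7.4 Thm. 7.16 (proof)] -/
theorem sum_umvirate_liftCut_le {T₀ : Finset (Fin n)} {s : ℕ} {I J : Fin s → Fin n} (hI : Function.Injective I)
    (F : Finset (Fin n) → ℝ) {B : ℝ}
    (hB : (∑ U ∈ subslice T₀ I J, F U) ≤ B * ((subslice T₀ I J).card : ℝ)) :
    (∑ π ∈ umvirate I J, F (cutOf T₀ π)) ≤ B * ((umvirate I J).card : ℝ) := by
  classical
  have hM := card_mul_sum_liftCut T₀ I J hI F
  rcases (subslice T₀ I J).eq_empty_or_nonempty with hS | hne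
  · -- empty sub-slice: the umvirate is empty too
    have hU : umvirate I J = ∅ := by
      refine Finset.eq_empty_of_forall_notMem fun π hπ => ?_
      have := cutOf_mem_subslice (T₀ := T₀) hπ
      rw [hS] at this
      exact Finset.notMem_empty _ this
    rw [hU]; simp
  · have hpos : (0 : ℝ) < (subslice T₀ I J).card := by exact_mod_cast Finset.card_pos.2 hne
    have hc : (0 : ℝ) ≤ (umvirate I J).card := by positivity
    -- |S|·Σ_π = |Umv|·Σ_U ≤ |Umv|·B·|S|
    have h1 : ((subslice T₀ I J).card : ℝ) * ∑ π ∈ umvirate I J, F (cutOf T₀ π) ≤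
        ((subslice T₀ I J).card : ℝ) * (B * ((umvirate I J).card : ℝ)) := by
      rw [hM]
      calc ((umvirate I J).card : ℝ) * ∑ U ∈ subslice T₀ I J, F U
          ≤ ((umvirate I J).card : ℝ) * (B * ((subslice T₀ I J).card : ℝ)) := mul_le_mul_of_nonneg_left hB hc
        _ = ((subslice T₀ I J).card : ℝ) * (B * ((umvirate I J).card : ℝ)) := by ring
    exact le_of_mul_le_mul_left h1 hpos

/-- **The lift of an `L¹`-global slice function is `L¹`-global on `S_n` with the same parameters**
("`g = Mf` […] is global"). [cite: FilmusKindlerLifshitzMinzer2024, §7.4 Thm. 7.16 (proof)] -/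
theorem isL1GlobalSn_liftCut {T₀ : Finset (Fin n)} {r γ : ℝ} {d : ℕ} {h : Finset (Fin n) → ℝ}
    (hh : IsL1GlobalSlice T₀ r γ d h) : IsL1GlobalSn r γ d (liftCut T₀ h) := by
  intro s hs I J hI hJ
  have := sum_umvirate_liftCut_le hI (fun U => |h U|) (hh s hs I J hI hJ)
  simpa only [liftCut_apply] using this

/-- **The lift of a biglobal slice function is biglobal on `S_n` with the same parameters**, so the tree's
PROVED Keevash–Lifshitz Theorem 3.1 (`GlobalLevelDInequalityBiglobal_holds`) applies to it.
[cite: FilmusKindlerLifshitzMinzer2024, §7.4 Thm. 7.16 (proof)] [cite: KeevashLifshitz2023, Thm. 3.1 (p. 17)] -/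
theorem isBiglobal_liftCut {T₀ : Finset (Fin n)} {r γ₁ γ₂ : ℝ} {d : ℕ} {h : Finset (Fin n) → ℝ}
    (hh : IsBiglobalSlice T₀ r γ₁ γ₂ d h) : IsBiglobal r γ₁ γ₂ d (liftCut T₀ h) := by
  intro s hs I J hI hJ
  obtain ⟨h1, h2⟩ := hh s hs I J hI hJ
  refine ⟨?_, ?_⟩
  · have := sum_umvirate_liftCut_le hI (fun U => |h U|) h1
    simpa only [liftCut_apply] using this
  · have := sum_umvirate_liftCut_le hI (fun U => h U ^ 2) h2
    simpa only [liftCut_apply] using this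

/-- **Consequence: the Keevash–Lifshitz level-`d` inequality for a lifted bounded `L¹`-global slice
function** — `|h| ≤ G` on the slice, `(r, γ, d)`-`L¹`-global there, `r > 1`, `0 < γ < G`,
`d ≤ min(⅛ log(G/γ), 10⁻⁵ n)`: `‖(Mh)^{=d}‖₂² ≤ γ² (5·10⁵ r² d⁻¹ log(G/γ))^d` on `S_n` (unconditional).
[cite: FilmusKindlerLifshitzMinzer2024, §7.4 Cor. 7.17 (the S_n → multislice transfer of the level-d inequality)] [cite: KeevashLifshitz2023, Thm. 3.1 (p. 17)] -/
theorem levelPart_sq_liftCut_le {T₀ : Finset (Fin n)} (h : Finset (Fin n) → ℝ) {r γ G : ℝ} {d : ℕ}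
    (hr : 1 < r) (hγ : 0 < γ) (hγG : γ < G) (hhG : ∀ U, |h U| ≤ G) (hglob : IsL1GlobalSlice T₀ r γ d h)
    (hd₁ : (d : ℝ) ≤ Real.log (G / γ) / 8) (hd₂ : (d : ℝ) ≤ (n : ℝ) / 10 ^ 5) :
    ‖levelPart n d (vec (liftCut T₀ h))‖ ^ 2 / n.factorial ≤
      γ ^ 2 * (5 * 10 ^ 5 * r ^ 2 * (1 / (d : ℝ)) * Real.log (G / γ)) ^ d :=
  levelPart_sq_le_of_isL1GlobalSn (liftCut T₀ h) hr hγ hγG (fun _ => hhG _) (isL1GlobalSn_liftCut hglob) hd₁ hd₂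

end Literature.Combinatorics.Additive.KeevashLifshitz

end
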